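/-
Copyright (c) 2026. All rights reserved.
Released under Apache 2.0 license as described in the file LICENSE.
Authors: abc-iut cell, seat abc-iut-L4-t9 (gen 3; block W2-B2, model of [AbsTopIII] Cor 3.7).
-/
import Literature.AnabelianGeometry.AbsoluteAnabelian.AbsTopIII.MLFGaloisArithmeticData
import Literature.AnabelianGeometry.AbsoluteAnabelian.AbsTopIII.MonoAnabelianComparisonMLF
import Mathlib.Topology.Algebra.MulAction
import HarnessLib

/-!
# [AbsTopIII] Def 3.1 (iv): the functors `λ^×`, `λ^{×pf}`, the natural transformations `ι_×`, `ι_log`,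
# and the MODEL of the input structure of Corollary 3.7

S. Mochizuki, *Topics in absolute anabelian geometry III* [MochizukiAbsTopIII2015] (kurims manuscript
`paper:url-5493eb38cbb7`), Def 3.1 (iv) p. 69: "the assignments (the ind-topological field `k̄`, with its
natural `Π_k`-action) `↦` (the ind-topological space `k̄^×`, with its natural `Π_k`-action) [resp.]
`↦` (the ind-topological space `(k̄^×)^pf`, with its natural `Π_k`-action) determine natural functors
`λ^× : 𝒞^MLF_TF → 𝒞^MLF_TS`; `λ^{×pf} : 𝒞^MLF_TF → 𝒞^MLF_TS` together with diagrams of functors [...]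
`ι_log : λ^× ∘ log_{TF,TF} → λ^{×pf}` [...] `ι_× : λ^× → λ^{×pf}`"; pp. 68–69: "`log_{TF,TF} : 𝒞^MLF_TF →
𝒞^MLF_TF` [...] Since `log_k̄` determines a functorial isomorphism between the fields `k̄`, `k~`, it
follows immediately that the functor `log_{TF,TF}` is isomorphic to the identity functor"; Cor 3.7 p. 86.

Second half of the construction (after `MLFGaloisArithmeticData.lean`), on the model categories of
`MLFGaloisModelCategories.lean` (abc-iut-L4-t9: `𝒳 = TFModel p`, `𝒩 = TSObj`, `𝔈 = TopGroupObj`):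

* `TFModel.lamTimesObj A = (Π_k ↷ k̄^×)`, `TFModel.lamTimesPfObj A = (Π_k ↷ (k̄^×)^pf)` as `TS`-pairs
  (actions through `ε_k`; continuity = open stabilisers; their arithmetic Galois group IS `G_k`:
  `lamTimesObj_actionKer`, `lamTimesPfObj_actionKer` — the latter by the FAITHFULNESS theorem of
  `MLFGaloisModelRigidity.lean`);
* `TFModel.lamTimes p`, `TFModel.lamTimesPf p : TFModel p ⥤ TSObj` — **`λ^×`, `λ^{×pf}`** (on morphisms
  via the rigidity theorem `φ_M = σ_φ ∈ Gal(ℚ̄_p/ℚ_p)`);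
* `TFModel.iotaTimes p : λ^× ⟶ λ^{×pf}` — **`ι_×`**; `TFModel.iotaLog p : 𝟭 ⋙ λ^× ⟶ λ^{×pf}` — **`ι_log`**
  IN LOG-COORDINATES: every object of `𝒳` carries the SAME arithmetic datum `ℚ̄_p`, and the output
  `(Π ↷ k~)` of `log_{TF,TF}` is identified with `(Π ↷ k̄)` along the functorial isomorphism
  `log_k̄ : k~ ⥲ k̄`; in these coordinates `log_{TF,TF} = 𝟭` and `ι_log` is `y ↦ [log_k̄⁻¹(y)]`
  (`iotaLogMap`); naturality = Galois-equivariance of the real `log_k̄` + rigidity;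
* `TFModel.modelSetting p : BiAnabelianSetting (TFModel p) TopGroupObj TSObj` — **the MODEL of the input
  structure of [AbsTopIII] Cor 3.7** (abc-iut-L4-t9's `BiAnabelianSetting`, `MonoAnabelianComparisonMLF`,
  retiring its `TODO-merge` line: every field is now a construction over Def 3.1 data).

HONEST FRAMING: a kernel MODEL of Def 3.1 (iii)/(iv) (residue characteristic `p`, fixed closure `ℚ̄_p`,
no "strictly Belyi type" condition, discrete topologies); nothing here bears on [IUTchIII] Cor. 3.12.
-/

set_option autoImplicit false

noncomputable section

namespace Literature.AnabelianGeometry.AbsoluteAnabelian.AbsTopIII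

open CategoryTheory Literature.NumberTheory.Transcendental

variable {p : ℕ} [hp : Fact p.Prime]

/-! ## The `TS`-pairs `λ^×(A) = (Π ↷ k̄^×)` and `λ^{×pf}(A) = (Π ↷ (k̄^×)^pf)` of a model object -/

namespace TFModel

variable (A : TFModel p)

/-- The `Π_k`-action on `k̄^×` through `ε_k` ("with its natural `Π_k`-action"); an instance on the
type synonym `TimesCarrier p` of THIS file, keyed by the model object `A` (it is also the action field of
the `TS`-pair `λ^×(A)` below). [cite: MochizukiAbsTopIII2015, Definition 3.1 (iv) p.69] -/
instance timesAction : MulAction A.pair.Pi (TimesCarrier p) where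
  smul g u := unitsGal (A.augQ g) u
  one_smul u := by
    change unitsGal (A.augQ 1) u = u
    rw [augQ_one]; exact unitsGal_one u
  mul_smul g h u := by
    change unitsGal (A.augQ (g * h)) u = unitsGal (A.augQ g) (unitsGal (A.augQ h) u)
    rw [augQ_mul]; exact unitsGal_mul _ _ u

/-- The `Π_k`-action on `(k̄^×)^pf` through `ε_k` (instance on the type synonym `TimesPfCarrier p`, keyed
by `A`; the action field of `λ^{×pf}(A)`). [cite: MochizukiAbsTopIII2015, Definition 3.1 (iv) p.69] -/
instance timesPfAction : MulAction A.pair.Pi (TimesPfCarrier p) where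
  smul g x := unitsPfGal (A.augQ g) x
  one_smul x := by
    change unitsPfGal (A.augQ 1) x = x
    rw [augQ_one]; exact unitsPfGal_one x
  mul_smul g h x := by
    change unitsPfGal (A.augQ (g * h)) x = unitsPfGal (A.augQ g) (unitsPfGal (A.augQ h) x)
    rw [augQ_mul]; exact unitsPfGal_mul _ _ x

/-- The stabiliser in `Π_k` of `u ∈ k̄^×` is open: it is the preimage under the continuous `ε_k` of the
(open, Krull topology) stabiliser of `u ∈ k̄` in `G_k`. [cite: MochizukiAbsTopIII2015, Definition 3.1 (i) p.67] -/
theorem isOpen_stabilizer_times (u : TimesCarrier p) :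
    IsOpen (MulAction.stabilizer A.pair.Pi u : Set A.pair.Pi) := by
  haveI := A.isAlgebraic
  have h := A.D.isOpen_stabilizer_comp (u.toUnits : PadicAlgCl p)
  have hset : (MulAction.stabilizer A.pair.Pi u : Set A.pair.Pi) =
      (MulAction.stabilizer (PadicAlgCl p ≃ₐ[A.k] PadicAlgCl p) (u.toUnits : PadicAlgCl p) :
        Set (PadicAlgCl p ≃ₐ[A.k] PadicAlgCl p)).preimage A.D.aug := by
    ext g
    change unitsGal (A.augQ g) u = u ↔
      A.D.aug g ∈ (MulAction.stabilizer (PadicAlgCl p ≃ₐ[A.k] PadicAlgCl p) (u.toUnits : PadicAlgCl p) :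
        Set (PadicAlgCl p ≃ₐ[A.k] PadicAlgCl p))
    rw [SetLike.mem_coe, MulAction.mem_stabilizer_iff, AlgEquiv.smul_def]
    exact ⟨fun hg => congrArg (fun w : TimesCarrier p => (w.toUnits : PadicAlgCl p)) hg,
      fun hg => TimesCarrier.ext hg⟩
  rw [hset]
  exact h

/-- The stabiliser in `Π_k` of a class in `(k̄^×)^pf` is open (it contains the stabiliser of a lift).
[cite: MochizukiAbsTopIII2015, Definition 3.1 (i) p.67] -/
theorem isOpen_stabilizer_timesPf (x : TimesPfCarrier p) :
    IsOpen (MulAction.stabilizer A.pair.Pi x : Set A.pair.Pi) := by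
  induction x using QuotientGroup.induction_on with
  | H u =>
    refine Subgroup.isOpen_mono ?_ (A.isOpen_stabilizer_times u)
    intro g hg
    rw [MulAction.mem_stabilizer_iff] at hg ⊢
    exact congrArg timesToPf hg

/-- **`λ^×(A) = (Π_k ↷ k̄^×)`** as a `TS`-pair (discrete space, action through `ε_k`, continuous because
stabilisers are open). [cite: MochizukiAbsTopIII2015, Definition 3.1 (iv) p.69] -/
abbrev lamTimesObj : TSObj :=
  ⟨{ Pi := A.pair.Pi, M := TimesCarrier p, instAction := A.timesAction,
     continuous_smul :=
       ((continuousSMul_iff_stabilizer_isOpen (M := A.pair.Pi) (X := TimesCarrier p)).2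
         A.isOpen_stabilizer_times).continuous_smul }⟩

/-- **`λ^{×pf}(A) = (Π_k ↷ (k̄^×)^pf)`** as a `TS`-pair. [cite: MochizukiAbsTopIII2015, Definition 3.1 (iv) p.69] -/
abbrev lamTimesPfObj : TSObj :=
  ⟨{ Pi := A.pair.Pi, M := TimesPfCarrier p, instAction := A.timesPfAction,
     continuous_smul :=
       ((continuousSMul_iff_stabilizer_isOpen (M := A.pair.Pi) (X := TimesPfCarrier p)).2
         A.isOpen_stabilizer_timesPf).continuous_smul }⟩

/-- The action in `λ^×(A)` is `g · u = ε_k(g)(u)`. [cite: MochizukiAbsTopIII2015, Definition 3.1 (iv) p.69] -/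
theorem lamTimesObj_smul (g : A.pair.Pi) (u : TimesCarrier p) : g • u = unitsGal (A.augQ g) u := rfl

/-- The action in `λ^{×pf}(A)` is `g · x = ε_k(g)(x)`. [cite: MochizukiAbsTopIII2015, Definition 3.1 (iv) p.69] -/
theorem lamTimesPfObj_smul (g : A.pair.Pi) (x : TimesPfCarrier p) : g • x = unitsPfGal (A.augQ g) x := rfl

/-- `g ∈ Π_k` acts trivially on the `TF`-pair `(Π_k ↷ k̄)` iff `ε_k(g)` fixes `k̄` pointwise.
[cite: MochizukiAbsTopIII2015, Definition 3.1 (ii) p.67] -/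
theorem mem_pair_actionKer_iff (g : A.pair.Pi) : g ∈ A.pair.actionKer ↔ ∀ x : PadicAlgCl p, A.augQ g x = x := by
  rw [GaloisFieldPair.actionKer, MonoidHom.mem_ker, RingEquiv.ext_iff]
  exact Iff.rfl

/-- **The arithmetic Galois group of `λ^×(A)` is that of `A`**: `g` acts trivially on `k̄^×` iff it acts
trivially on `k̄`. [cite: MochizukiAbsTopIII2015, Definition 3.1 (iv) p.69] -/
theorem lamTimesObj_actionKer : A.lamTimesObj.actionKer = A.pair.actionKer := by
  ext g
  rw [TSObj.mem_actionKer_iff, mem_pair_actionKer_iff]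
  constructor
  · intro h x
    rcases eq_or_ne x 0 with rfl | hx
    · exact map_zero _
    · exact congrArg (fun w : TimesCarrier p => (w.toUnits : PadicAlgCl p))
        (h (TimesCarrier.ofUnits (Units.mk0 x hx)))
  · intro h u
    exact TimesCarrier.ext (h _)

/-- **The arithmetic Galois group of `λ^{×pf}(A)` is that of `A`** (FAITHFULNESS of `G_k` on `k̄^×/μ`,
`PadicAlgCl.algEquiv_eq_refl_of_forall_units`). [cite: MochizukiAbsTopIII2015, Definition 3.1 (iv) p.69] -/
theorem lamTimesPfObj_actionKer : A.lamTimesPfObj.actionKer = A.pair.actionKer := by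
  ext g
  rw [TSObj.mem_actionKer_iff, mem_pair_actionKer_iff]
  constructor
  · intro h
    have hσ : A.augQ g = AlgEquiv.refl := by
      refine PadicAlgCl.algEquiv_eq_refl_of_forall_units (A.augQ g) fun u => ?_
      have hu := h (timesToPf (TimesCarrier.ofUnits u))
      rw [A.lamTimesPfObj_smul, unitsPfGal_mk, timesToPf_eq_iff] at hu
      simpa using hu
    intro x
    rw [hσ]; rfl
  · intro h x
    induction x using QuotientGroup.induction_on with
    | H u =>
      change unitsPfGal (A.augQ g) (timesToPf u) = timesToPf u
      rw [unitsPfGal_mk]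
      exact congrArg timesToPf (TimesCarrier.ext (h _))

/-! ## The functors `λ^×`, `λ^{×pf}` and the natural transformations `ι_×`, `ι_log` -/

variable {A} {B : TFModel p}

/-- `σ_φ ∘ ε₁(g) = ε₂(φ_Π g) ∘ σ_φ` in `Gal(ℚ̄_p/ℚ_p)` (the intertwining relation of a Galois-isomorphism).
[cite: MochizukiAbsTopIII2015, Definition 3.1 (ii) p.67] -/
theorem Hom.galois_mul_augQ (f : Hom A B) (g : A.pair.Pi) :
    f.galois * A.augQ g = B.augQ (f.hom.homPi g) * f.galois := by
  ext y
  rw [AlgEquiv.mul_apply, AlgEquiv.mul_apply, Hom.galois_apply, Hom.galois_apply, Hom.augQ_homPi_apply]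

/-- `λ^×` on a Galois-isomorphism `φ`: `(φ_Π, φ_M|_{k̄^×})`. [cite: MochizukiAbsTopIII2015, Definition 3.1 (iv) p.69] -/
def lamTimesMap (f : A ⟶ B) : A.lamTimesObj ⟶ B.lamTimesObj where
  homPi := (f : Hom A B).hom.homPi
  continuous_homPi := (f : Hom A B).hom.continuous_homPi
  bijective_homPi := (f : Hom A B).bijective
  isOpenMap_homPi := (f : Hom A B).isOpenMap
  homM := unitsGal (f : Hom A B).galois
  continuous_homM :=
    (continuous_of_discreteTopology : Continuous (unitsGal (f : Hom A B).galois : TimesCarrier p → _))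
  smul_comm g u := by
    change unitsGal (f : Hom A B).galois (unitsGal (A.augQ g) u) =
      unitsGal (B.augQ ((f : Hom A B).hom.homPi g)) (unitsGal (f : Hom A B).galois u)
    rw [← unitsGal_mul, ← unitsGal_mul, Hom.galois_mul_augQ]
  comap_ker := by rw [lamTimesObj_actionKer, lamTimesObj_actionKer]; exact (f : Hom A B).hom.comap_ker

/-- `λ^{×pf}` on a Galois-isomorphism `φ`: `(φ_Π, φ_M^pf)`. [cite: MochizukiAbsTopIII2015, Definition 3.1 (iv) p.69] -/
def lamTimesPfMap (f : A ⟶ B) : A.lamTimesPfObj ⟶ B.lamTimesPfObj where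
  homPi := (f : Hom A B).hom.homPi
  continuous_homPi := (f : Hom A B).hom.continuous_homPi
  bijective_homPi := (f : Hom A B).bijective
  isOpenMap_homPi := (f : Hom A B).isOpenMap
  homM := unitsPfGal (f : Hom A B).galois
  continuous_homM :=
    (continuous_of_discreteTopology : Continuous (unitsPfGal (f : Hom A B).galois : TimesPfCarrier p → _))
  smul_comm g x := by
    change unitsPfGal (f : Hom A B).galois (unitsPfGal (A.augQ g) x) =
      unitsPfGal (B.augQ ((f : Hom A B).hom.homPi g)) (unitsPfGal (f : Hom A B).galois x)
    rw [← unitsPfGal_mul, ← unitsPfGal_mul, Hom.galois_mul_augQ]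
  comap_ker := by
    rw [lamTimesPfObj_actionKer, lamTimesPfObj_actionKer]; exact (f : Hom A B).hom.comap_ker

variable (p)

/-- **The functor `λ^× : 𝒳 → 𝒩`**, `(Π ↷ k̄) ↦ (Π ↷ k̄^×)`. [cite: MochizukiAbsTopIII2015, Definition 3.1 (iv) p.69] -/
def lamTimes : TFModel p ⥤ TSObj where
  obj A := A.lamTimesObj
  map f := lamTimesMap f
  map_id _ := TSObj.Hom.ext rfl (funext fun _ => TimesCarrier.ext rfl)
  map_comp _ _ := TSObj.Hom.ext rfl (funext fun _ => TimesCarrier.ext rfl)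

/-- **The functor `λ^{×pf} : 𝒳 → 𝒩`**, `(Π ↷ k̄) ↦ (Π ↷ (k̄^×)^pf)`. [cite: MochizukiAbsTopIII2015, Definition 3.1 (iv) p.69] -/
def lamTimesPf : TFModel p ⥤ TSObj where
  obj A := A.lamTimesPfObj
  map f := lamTimesPfMap f
  map_id A := TSObj.Hom.ext rfl (funext fun x => by
    change unitsPfGal (Hom.galois (𝟙 A : Hom A A)) x = x
    induction x using QuotientGroup.induction_on with
    | H u => exact congrArg timesToPf (TimesCarrier.ext rfl))
  map_comp f g := TSObj.Hom.ext rfl (funext fun x => by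
    change unitsPfGal (Hom.galois (f ≫ g : Hom _ _)) x =
      unitsPfGal (Hom.galois (g : Hom _ _)) (unitsPfGal (Hom.galois (f : Hom _ _)) x)
    induction x using QuotientGroup.induction_on with
    | H u => exact congrArg timesToPf (TimesCarrier.ext rfl))

/-- **`ι_× : λ^× → λ^{×pf}`**, "the natural transformation induced by the natural map `k̄^× → (k̄^×)^pf`"
(identity on `Π`; a morphism of `TS`-pairs because `G_k` acts faithfully on `(k̄^×)^pf`).
[cite: MochizukiAbsTopIII2015, Definition 3.1 (iv) p.69] -/
def iotaTimes : lamTimes p ⟶ lamTimesPf p where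
  app A :=
    { homPi := MonoidHom.id _
      continuous_homPi := continuous_id
      bijective_homPi := Function.bijective_id
      isOpenMap_homPi := IsOpenMap.id
      homM := timesToPf
      continuous_homM :=
        (continuous_of_discreteTopology : Continuous (timesToPf : TimesCarrier p → TimesPfCarrier p))
      smul_comm := fun _ _ => rfl
      comap_ker := by
        change (A.lamTimesPfObj.actionKer).comap (MonoidHom.id _) = A.lamTimesObj.actionKer
        rw [Subgroup.comap_id, lamTimesPfObj_actionKer, lamTimesObj_actionKer] }
  naturality := fun _ _ _ => TSObj.Hom.ext rfl rfl

/-- **`ι_log : λ^× ∘ log_{TF,TF} → λ^{×pf}`** in log-coordinates (`log_{TF,TF} = 𝟭`, see the module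
docstring): on arithmetic data the map `y ↦ [log_k̄⁻¹(y)]`, `k̄^× = (k~)^× ↪ k~ = (𝒪^×_k̄)^pf ↪ (k̄^×)^pf`;
equivariance and naturality by `iotaLogMap_unitsGal` (Galois-equivariance of the real `log_k̄`).
[cite: MochizukiAbsTopIII2015, Definition 3.1 (iv) p.69] -/
def iotaLog : 𝟭 (TFModel p) ⋙ lamTimes p ⟶ lamTimesPf p where
  app A :=
    { homPi := MonoidHom.id _
      continuous_homPi := continuous_id
      bijective_homPi := Function.bijective_id
      isOpenMap_homPi := IsOpenMap.id
      homM := iotaLogMap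
      continuous_homM :=
        (continuous_of_discreteTopology : Continuous (iotaLogMap : TimesCarrier p → TimesPfCarrier p))
      smul_comm := fun g u => iotaLogMap_unitsGal (A.augQ g) u
      comap_ker := by
        change (A.lamTimesPfObj.actionKer).comap (MonoidHom.id _) = A.lamTimesObj.actionKer
        rw [Subgroup.comap_id, lamTimesPfObj_actionKer, lamTimesObj_actionKer] }
  naturality := fun _ _ f => TSObj.Hom.ext rfl (funext fun u => iotaLogMap_unitsGal (Hom.galois (f : Hom _ _)) u)

/-- `λ^×` does not change the Galois group: `λ^× ⋙ (𝒩 → 𝔈) ≅ (𝒳 → 𝔈)` (the identity on `Π`).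
[cite: MochizukiAbsTopIII2015, Definition 3.1 (iii) p.68] -/
def lamTimesGal : lamTimes p ⋙ TSObj.gal ≅ TFModel.gal p :=
  NatIso.ofComponents (fun _ => Iso.refl _) (fun _ => TopGroupObj.Hom.ext fun _ => rfl)

/-- `λ^{×pf}` does not change the Galois group. [cite: MochizukiAbsTopIII2015, Definition 3.1 (iii) p.68] -/
def lamTimesPfGal : lamTimesPf p ⋙ TSObj.gal ≅ TFModel.gal p :=
  NatIso.ofComponents (fun _ => Iso.refl _) (fun _ => TopGroupObj.Hom.ext fun _ => rfl)

/-- **The MODEL of the input structure of [AbsTopIII] Cor 3.7** (rows ≤ 4 of the diagram `𝒟†`, `T = T𝔽`):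
`𝒳 = TFModel p`, `𝔈 = TopGroupObj`, `𝒩 = TSObj`; `gal = (Π ↷ M) ↦ Π`; `log_{TF,TF} = 𝟭` with
`logIsoId = refl` (log-coordinates: "`log_{TF,TF}` is isomorphic to the identity functor"); `λ^×`,
`λ^{×pf}`, `ι_log`, `ι_×` the constructions above; `𝒩 → 𝔈` the functor `(Π ↷ M) ↦ Π`. This retires the
`TODO-merge` of `MonoAnabelianComparisonMLF.lean` (abc-iut-L4-t9): every field of `BiAnabelianSetting`
is a construction over Def 3.1 data. [cite: MochizukiAbsTopIII2015, Cor 3.7 p.86] -/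
def modelSetting : BiAnabelianSetting (TFModel p) TopGroupObj TSObj where
  gal := TFModel.gal p
  log := 𝟭 (TFModel p)
  logIsoId := Iso.refl _
  lamTimes := lamTimes p
  lamTimesPf := lamTimesPf p
  iotaLog := iotaLog p
  iotaTimes := iotaTimes p
  spaceGal := TSObj.gal
  lamTimesGal := lamTimesGal p
  lamTimesPfGal := lamTimesPfGal p

end TFModel

end Literature.AnabelianGeometry.AbsoluteAnabelian.AbsTopIII

end
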